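import Summits.AtomisticToContinuum.FouriersLaw.Theses.PhononMeanFreePath
import Summits.AtomisticToContinuum.FouriersLaw.Theorems.BoundaryKubo.Negative.LoadBearing
import Summits.AtomisticToContinuum.FouriersLaw.Theorems.PhononMeanFreePathBoundaryKuboKernelContinuity

/-!
# The Feller property jointly in the bath temperatures and the initial condition
(stub `stub_jointFeller` of line `gibbs-ttcf`, crux stmt-AtomisticToContinuum-11812
`PhononMeanFreePath.BoundaryKubo`)

For the pinned chain `P = pinnedChain ω₂ lam β γ` (all four `> 0`) with `N + 1` sites, `s ≥ 0` and a
bounded continuous observable `g`, the map `(T_L, T_R, z) ↦ ∫ g dK^{T_L,T_R}_s(z)` is continuous on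
`(0,∞)² × PhaseSpace (N+1)` (in fact on all of `ℝ² × PhaseSpace (N+1)`), `K = OscillatorChain.transitionKernel`
the CONSTRUCTED kernels of `LangevinChainKernel.lean`.

Proof. `K^{a,b}_s(z)` is the law under `wienerPair` of `Φ^{a,b}_s(z, B(ω)) = chainFlow z η^{a,b}(B(ω)) s`
(`pinnedChain_integral_transitionKernel`), so by dominated convergence (dominating constant the bound of
`g`) it suffices that `(a, b, z) ↦ Φ^{a,b}_s(z, B(ω))` is continuous for EVERY `ω`. The flow is
continuous in the forcing in the sup norm on `[0, s]` UNIFORMLY over initial conditions in an energy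
sublevel set `{H ≤ E}` (`pinnedChain_exists_norm_chainFlow_sub_lt`), and continuous in the initial
condition at a fixed forcing (`pinnedChain_continuous_chainFlow_left`); with `E = H(z₀) + 1` (valid near
`z₀` by continuity of `H`) the triangle inequality
`‖Φ(z, η_c) - Φ(z₀, η_{c₀})‖ ≤ ‖Φ(z, η_c) - Φ(z, η_{c₀})‖ + ‖Φ(z, η_{c₀}) - Φ(z₀, η_{c₀})‖` gives joint
continuity in `(c, z)` for any parametrised forcing `c ↦ η_c` that is sup-norm continuous at `c₀`
(`pinnedChain_continuousAt_chainFlow_param_prod`). The forcing `chainNoise (N+1) c_L c_R w` is linear in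
the amplitudes with coefficients bounded on `[0, s]` (`norm_chainNoise_sub_le`), and the amplitudes
`√(2γT_b)` are continuous in the temperatures.
-/

noncomputable section

open scoped NNReal ENNReal Topology
open MeasureTheory Filter Set

namespace Summit.AtomisticToContinuum.FouriersLaw.Theorems.BoundaryKubo.GibbsTtcf

open Literature.MathematicalPhysics.KineticTheory.HeatConduction
open Literature.MathematicalPhysics.KineticTheory Literature.Probability.Process OscillatorChain
open ProbabilityTheory
open Summit.AtomisticToContinuum.FouriersLaw.Theorems.BoundaryKubo.Negative.LoadBearing
  (kuboIntegrand kuboValue LimitClause UniqueSteady SteadyFamily boundaryKubo_iff)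

/-! ### The noise path depends continuously on the amplitudes, uniformly on compact time intervals -/

/-- The momentum-noise path `chainNoise n c_L c_R w` is continuous in the pair of amplitudes
`c = (c_L, c_R)` in the sup norm on `[0, T]`, for every pair of raw driving paths `w` (it is linear in
the amplitudes with coefficients bounded on `[0, T]`). [folklore] -/
theorem eventually_norm_chainNoise_sub_le (n : ℕ) (w : WienerPair) (T : ℝ) (c₀ : ℝ × ℝ) {δ : ℝ}
    (hδ : 0 < δ) :
    ∀ᶠ c in 𝓝 c₀, ∀ u ∈ Icc 0 T, ‖chainNoise n c.1 c.2 w u - chainNoise n c₀.1 c₀.2 w u‖ ≤ δ := by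
  -- bounds of the two regularised driving paths on `[0, T]`
  obtain ⟨A₁, hA₁⟩ := isCompact_Icc.exists_bound_of_continuousOn
    (((continuous_pathRegularize_toNNReal (E := ℝ) w.1).sub continuous_const).continuousOn
      (s := Icc 0 T)) (f := fun u : ℝ => pathRegularize w.1 u.toNNReal - pathRegularize w.1 0)
  obtain ⟨A₂, hA₂⟩ := isCompact_Icc.exists_bound_of_continuousOn
    (((continuous_pathRegularize_toNNReal (E := ℝ) w.2).sub continuous_const).continuousOn
      (s := Icc 0 T)) (f := fun u : ℝ => pathRegularize w.2 u.toNNReal - pathRegularize w.2 0)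
  have hg : Tendsto (fun c : ℝ × ℝ => |c.1 - c₀.1| * |A₁| + |c.2 - c₀.2| * |A₂|) (𝓝 c₀) (𝓝 0) := by
    have hc : Continuous fun c : ℝ × ℝ => |c.1 - c₀.1| * |A₁| + |c.2 - c₀.2| * |A₂| := by fun_prop
    simpa using hc.tendsto c₀
  filter_upwards [hg.eventually_lt_const hδ] with c hc u hu
  refine (norm_chainNoise_sub_le n _ _ _ _ w u).trans (le_of_lt (lt_of_le_of_lt ?_ hc))
  have h1 := hA₁ u hu
  have h2 := hA₂ u hu
  rw [Real.norm_eq_abs] at h1 h2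
  exact add_le_add (mul_le_mul_of_nonneg_left (h1.trans (le_abs_self _)) (abs_nonneg _))
    (mul_le_mul_of_nonneg_left (h2.trans (le_abs_self _)) (abs_nonneg _))

/-! ### Joint continuity of the flow in (forcing, initial condition) -/

section Pinned

variable {ω₂ lam β γ : ℝ} (hω : 0 < ω₂) (hl : 0 ≤ lam) (hβ : 0 ≤ β) (hγ : 0 ≤ γ)
include hω hl hβ hγ

/-- **The flow is jointly continuous in a parametrised noise path and the initial condition.** If the
continuous noise paths `G c` depend on the parameter `c` continuously at `c₀` in the sup norm on
`[0, T]`, then `(c, x) ↦ chainFlow x (G c) t` is continuous at `(c₀, x₀)` for `t ∈ [0, T]` and every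
`x₀`: the `ε`-`δ` continuity of the flow in the noise UNIFORMLY over the energy sublevel set
`{H ≤ H(x₀) + 1}` (`pinnedChain_exists_norm_chainFlow_sub_lt`, noise bound `M₀ + 1` with `M₀` a bound of
`G c₀` on `[0, T]`), the continuity of `x ↦ chainFlow x (G c₀) t`
(`pinnedChain_continuous_chainFlow_left`) and the triangle inequality. [folklore] -/
theorem pinnedChain_continuousAt_chainFlow_param_prod (n : ℕ) {X : Type*} [TopologicalSpace X]
    {G : X → ℝ → Fin n → ℝ} (hG : ∀ c, Continuous (G c)) {T : ℝ} {c₀ : X}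
    (hU : ∀ δ : ℝ, 0 < δ → ∀ᶠ c in 𝓝 c₀, ∀ t ∈ Icc 0 T, ‖G c t - G c₀ t‖ ≤ δ) {t : ℝ}
    (ht : t ∈ Icc 0 T) (x₀ : PhaseSpace n) :
    ContinuousAt (fun p : X × PhaseSpace n => (pinnedChain ω₂ lam β γ).chainFlow n p.2 (G p.1) t)
      (c₀, x₀) := by
  set P := pinnedChain ω₂ lam β γ with hP
  obtain ⟨M₀, -, hM⟩ := exists_noiseBound (hG c₀) T
  rw [ContinuousAt, Metric.tendsto_nhds]
  intro ε hε
  have hε2 : 0 < ε / 2 := half_pos hε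
  obtain ⟨δ, hδ, hcont⟩ := pinnedChain_exists_norm_chainFlow_sub_lt hω hl hβ hγ n
    (P.hamiltonian n x₀ + 1) (M₀ + 1) T hε2
  -- parameters near `c₀`: the noise paths are uniformly `min δ 1`-close on `[0, T]`
  have h1 := hU (min δ 1) (lt_min hδ one_pos)
  -- initial conditions near `x₀`: energy at most `H x₀ + 1`
  have h2 : ∀ᶠ x in 𝓝 x₀, P.hamiltonian n x ≤ P.hamiltonian n x₀ + 1 := by
    have hc := (pinnedChain_continuous_hamiltonian ω₂ lam β γ n).continuousAt (x := x₀)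
    have hlt : P.hamiltonian n x₀ < P.hamiltonian n x₀ + 1 := lt_add_one _
    exact (hc.eventually (Iio_mem_nhds hlt)).mono fun x hx => le_of_lt hx
  -- initial conditions near `x₀`: the flow driven by the fixed noise `G c₀` is `ε/2`-close
  have h3 : ∀ᶠ x in 𝓝 x₀, dist (P.chainFlow n x (G c₀) t) (P.chainFlow n x₀ (G c₀) t) < ε / 2 := by
    have hc := (pinnedChain_continuous_chainFlow_left hω hl hβ hγ n (hG c₀) t).continuousAt
      (x := x₀)
    exact Metric.tendsto_nhds.1 hc _ hε2
  filter_upwards [h1.prod_nhds (h2.and h3)] with p hp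
  obtain ⟨hc, hx, hx'⟩ := hp
  have hM₁ : ∀ u ∈ Icc 0 T, ‖G p.1 u‖ ≤ M₀ + 1 := fun u hu => by
    have h1 := hM u hu
    have h2 := (hc u hu).trans (min_le_right _ _)
    calc ‖G p.1 u‖ = ‖G c₀ u + (G p.1 u - G c₀ u)‖ := by abel_nf
      _ ≤ ‖G c₀ u‖ + ‖G p.1 u - G c₀ u‖ := norm_add_le _ _
      _ ≤ M₀ + 1 := add_le_add h1 h2
  have hM₂ : ∀ u ∈ Icc 0 T, ‖G c₀ u‖ ≤ M₀ + 1 := fun u hu => (hM u hu).trans (by linarith)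
  have hA : ‖P.chainFlow n p.2 (G p.1) t - P.chainFlow n p.2 (G c₀) t‖ < ε / 2 :=
    hcont p.2 hx (G p.1) (G c₀) (hG p.1) (hG c₀) hM₁ hM₂
      (fun u hu => (hc u hu).trans (min_le_left _ _)) t ht
  rw [dist_eq_norm] at hx' ⊢
  calc ‖P.chainFlow n p.2 (G p.1) t - P.chainFlow n x₀ (G c₀) t‖
      = ‖(P.chainFlow n p.2 (G p.1) t - P.chainFlow n p.2 (G c₀) t) +
          (P.chainFlow n p.2 (G c₀) t - P.chainFlow n x₀ (G c₀) t)‖ := by rw [sub_add_sub_cancel]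
    _ ≤ ‖P.chainFlow n p.2 (G p.1) t - P.chainFlow n p.2 (G c₀) t‖ +
          ‖P.chainFlow n p.2 (G c₀) t - P.chainFlow n x₀ (G c₀) t‖ := norm_add_le _ _
    _ < ε / 2 + ε / 2 := add_lt_add hA hx'
    _ = ε := add_halves ε

/-- **The flow is jointly continuous in the pair of noise amplitudes and the initial condition**, for
every pair of raw driving paths and every `t ≥ 0`. [folklore] -/
theorem pinnedChain_continuous_chainFlow_chainNoise_prod (n : ℕ) (w : WienerPair) {t : ℝ}
    (ht : 0 ≤ t) :
    Continuous fun p : (ℝ × ℝ) × PhaseSpace n =>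
      (pinnedChain ω₂ lam β γ).chainFlow n p.2 (chainNoise n p.1.1 p.1.2 w) t := by
  refine continuous_iff_continuousAt.2 ?_
  rintro ⟨c₀, x₀⟩
  exact pinnedChain_continuousAt_chainFlow_param_prod hω hl hβ hγ n
    (G := fun c : ℝ × ℝ => chainNoise n c.1 c.2 w) (fun c => continuous_chainNoise _ _ w) (T := t)
    (fun δ hδ => eventually_norm_chainNoise_sub_le n w t c₀ hδ) ⟨ht, le_rfl⟩ x₀

/-- **The solution map is jointly continuous in the two bath temperatures and the initial
condition**, for every pair of raw driving paths and every `t ≥ 0` (the amplitudes `√(2γT_b)` are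
continuous in `T_b`). [folklore] -/
theorem pinnedChain_continuous_solMap_temp_prod (n : ℕ) {t : ℝ} (ht : 0 ≤ t) (w : WienerPair) :
    Continuous fun p : ℝ × ℝ × PhaseSpace n =>
      (pinnedChain ω₂ lam β γ).solMap n p.1 p.2.1 t p.2.2 w := by
  have h1 : Continuous fun p : ℝ × ℝ × PhaseSpace n =>
      ((Real.sqrt (2 * (pinnedChain ω₂ lam β γ).γ * p.1),
        Real.sqrt (2 * (pinnedChain ω₂ lam β γ).γ * p.2.1)), p.2.2) := by
    fun_prop
  have h2 := (pinnedChain_continuous_chainFlow_chainNoise_prod hω hl hβ hγ n w ht).comp h1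
  unfold OscillatorChain.solMap
  exact h2

/-- **The Feller property jointly in the bath temperatures and the initial condition**, on all of
`ℝ² × PhaseSpace n`: `(T_L, T_R, z) ↦ ∫ g dK^{T_L,T_R}_t(z) = E g(Φ^{T_L,T_R}_t(z, B))` is continuous for
bounded continuous `g` (pathwise joint continuity of the solution map and dominated convergence under
`wienerPair`; the Feller pattern of `pinnedChain_continuous_integral_transitionKernel`). [folklore] -/
theorem pinnedChain_continuous_integral_transitionKernel_prod (n : ℕ) (t : ℝ≥0)
    {g : PhaseSpace n → ℝ} (hg : Continuous g) {R : ℝ} (hR : ∀ y, ‖g y‖ ≤ R) :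
    Continuous fun p : ℝ × ℝ × PhaseSpace n =>
      ∫ y, g y ∂((pinnedChain ω₂ lam β γ).transitionKernel n p.1 p.2.1 t p.2.2) := by
  have h : (fun p : ℝ × ℝ × PhaseSpace n =>
        ∫ y, g y ∂((pinnedChain ω₂ lam β γ).transitionKernel n p.1 p.2.1 t p.2.2)) =
      fun p => ∫ ω, g ((pinnedChain ω₂ lam β γ).solMap n p.1 p.2.1 t p.2.2 (pairPath ω))
        ∂wienerPair := by
    funext p
    exact pinnedChain_integral_transitionKernel hω hl hβ hγ n p.1 p.2.1 t p.2.2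
      hg.aestronglyMeasurable
  rw [h]
  refine continuous_of_dominated (bound := fun _ => R) (fun p => ?_) (fun p => ?_)
    (integrable_const R) ?_
  · exact (hg.measurable.comp
      (pinnedChain_measurable_solMap_pairPath_right hω hl hβ hγ n p.1 p.2.1 t
        p.2.2)).aestronglyMeasurable
  · exact Eventually.of_forall fun ω => hR _
  · exact Eventually.of_forall fun ω =>
      hg.comp (pinnedChain_continuous_solMap_temp_prod hω hl hβ hγ n t.coe_nonneg (pairPath ω))

end Pinned

/-! ### The stub -/

/-- **The Feller property jointly in the bath temperatures and the initial condition** (stub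
`stub_jointFeller` of line `gibbs-ttcf`): for the pinned chain with `N + 1` sites, `s ≥ 0` and a
bounded continuous `g`, `(T_L, T_R, z) ↦ ∫ g dK^{T_L,T_R}_s(z)` is continuous on
`(0,∞)² × PhaseSpace (N+1)` (restriction of `pinnedChain_continuous_integral_transitionKernel_prod`,
which holds on all of `ℝ² × PhaseSpace (N+1)`). [folklore] -/
theorem stub_jointFeller :
    ∀ ω₂ lam β γ : ℝ, 0 < ω₂ → 0 < lam → 0 < β → 0 < γ → ∀ (N : ℕ) (s : ℝ≥0)
      (g : PhaseSpace (N + 1) → ℝ), Continuous g → (∃ B : ℝ, ∀ y, |g y| ≤ B) →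
      ContinuousOn (fun p : ℝ × ℝ × PhaseSpace (N + 1) =>
          ∫ y, g y ∂((pinnedChain ω₂ lam β γ).transitionKernel (N + 1) p.1 p.2.1 s p.2.2))
        (Set.Ioi (0 : ℝ) ×ˢ (Set.Ioi (0 : ℝ) ×ˢ (Set.univ : Set (PhaseSpace (N + 1))))) := by
  intro ω₂ lam β γ hω hl hβ hγ N s g hg hgb
  obtain ⟨B, hB⟩ := hgb
  exact (pinnedChain_continuous_integral_transitionKernel_prod hω hl.le hβ.le hγ.le (N + 1) s hg
    (fun y => by rw [Real.norm_eq_abs]; exact hB y)).continuousOn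

end Summit.AtomisticToContinuum.FouriersLaw.Theorems.BoundaryKubo.GibbsTtcf

end
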